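import Literature.Probability.RandomPlanarGeometry.SLESameSideMartingale
import Literature.Probability.RandomPlanarGeometry.SLEKappaFourKernel
import Literature.Probability.RandomPlanarGeometry.SLERealAvoidance
import Literature.Analysis.Calculus.SmoothIntervalExtension
import HarnessLib

/-!
# Rohde–Schramm's Lemma 7.2 at `κ = 4`: the SLE₄ trace avoids every fixed real point

Trunk T-STOCH. We prove the case `κ = 4` of S. Rohde, O. Schramm, *Basic properties of SLE*,
Ann. of Math. 161 (2005), Lemma 7.2 (p. 909): for `x ∈ ℝ ∖ {0}`, almost surely `x ∉ cl γ[0, ∞)`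
for the SLE₄ trace `γ` (`ae_ofReal_notMem_closure_range_sleTrace_four`, given that SLE₄ is
generated by a curve, `HasSLETrace 4`). The printed proof: with `0 < y < x`,
`Q(t) = log gₜ'(x) - log(gₜ(x) - gₜ(y))` is increasing, the distance from `x` to `∂Hₜ` is at
least `e^{-Q(t)}/4` (Schwarz reflection and Koebe; here `Loewner.IsGeneratedByCurve.le_dist_apply_ofReal`
of `LoewnerRealKoebe`), and `Q(t) - G(r_t)` is a local martingale with `sup G < ∞`, whence
`E[sup Q] < ∞`. We run it in Lawler's variable `Z = X/(X - Y) = 1 + 1/r` with the bounded scale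
function `G̃` of `SLEKappaFourKernel` (`|G̃| ≤ 2`, no dilogarithm):

* `Loewner.IsGeneratedByCurve.ofReal_notMem_closure_range_of_gap_bound` (**deterministic**): if
  `T_y = ∞` and `Q` is bounded then `x ∉ cl γ[0, ∞)`.
* `integral_sleKappaFourStopped_le` (**Itô step**): for the flows stopped at the same-side
  stopping time `ρ` of `SLESameSideMartingale`, `E ∫₀^{N∧ρ} q(X, Y) ds ≤ 4`, where
  `q(v, u) = 2/(vu) - 2/v² ≥ 0` is the rate of `Q` (`Q(t) = -log(x-y) + ∫₀ᵗ q`): the process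
  `G̃(Z_{t∧ρ}) - ∫₀^{t∧ρ} q` is a martingale (`martingale_apply_sameSideRatio_sub_timeIntegral`
  with the `κ = 4` drift identity `sameSideItoDrift_four_eq_rate`).
* `ae_exists_forall_sleKappaFourRaw_le` (**limiting argument**): a.s. `sup_t ∫₀ᵗ q < ∞` (Markov's
  inequality on increasing box events exhausting `{T_y = ∞}`, as in `SLELogDerivMartingale`).

## References

* S. Rohde, O. Schramm, *Basic properties of SLE*, Ann. of Math. 161 (2005), Lemma 7.2 and its
  proof (p. 909).
* G. F. Lawler, *Conformally Invariant Processes in the Plane*, AMS (2005), Prop. 6.33 (the ratio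
  `Z`), §4.1.
-/

noncomputable section

open MeasureTheory ProbabilityTheory Filter Set Topology Metric
open scoped NNReal ENNReal

namespace Literature.Probability.RandomPlanarGeometry

open Loewner Literature.Probability.Process Literature.Analysis.FunctionSpaces
  Literature.Analysis.Calculus

/-! ### The rate `q` and the `κ = 4` drift identity -/

/-- The **rate of `Q`**: `q(v, u) = 2/(vu) - 2/v²` (`≥ 0` for `0 < u ≤ v`).
[cite: RohdeSchramm2005, proof of Lemma 7.2 (p. 909)] -/
def kappaFourRate (v u : ℝ) : ℝ :=
  2 / (v * u) - 2 / v ^ 2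

/-- `q(v, u) ≥ 0` for `0 < u ≤ v`. [folklore] -/
theorem kappaFourRate_nonneg {v u : ℝ} (hu : 0 < u) (huv : u ≤ v) : 0 ≤ kappaFourRate v u := by
  have hv : 0 < v := hu.trans_le huv
  rw [kappaFourRate, sub_nonneg, sq]
  exact div_le_div_of_nonneg_left zero_le_two (mul_pos hv hu) (mul_le_mul_of_nonneg_left huv hv.le)

/-- **The `κ = 4` drift identity**: if `f' = k` and `f'' = k'` at `z = v/(v-u)` (`k` the kernel
`log z/(z(z-1))` of `SLEKappaFourKernel`), then the Itô drift of `f(Z)` along the two same-side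
flows is the rate of `Q`: `𝓛f(v, u) = q(v, u)` (`κ = 4`). This is the equation
`s(1+s)² G'' + s(1+s) G' = 1` of Rohde–Schramm's proof of Lemma 7.2 (p. 909) in the variable
`z = 1 + 1/s`. [cite: RohdeSchramm2005, proof of Lemma 7.2 (p. 909)] -/
theorem sameSideItoDrift_four_eq_rate {f : ℝ → ℝ} {v u : ℝ} (hu : 0 < u) (huv : u < v)
    (hf1 : deriv f (v / (v - u)) = kappaFourKernel (v / (v - u)))
    (hf2 : iteratedDeriv 2 f (v / (v - u)) = kappaFourKernelDeriv (v / (v - u))) :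
    sameSideItoDrift 4 f v u = kappaFourRate v u := by
  have hv : 0 < v := hu.trans huv
  have hvne : v ≠ 0 := hv.ne'
  have hune : u ≠ 0 := hu.ne'
  have hd : 0 < v - u := by linarith
  have hdne : v - u ≠ 0 := hd.ne'
  set L : ℝ := Real.log (v / (v - u)) with hL
  have hz1 : v / (v - u) - 1 = u / (v - u) := by field_simp; ring
  simp only [sameSideItoDrift, kappaFourRate, hf1, hf2, kappaFourKernel, kappaFourKernelDeriv, ← hL, hz1]
  push_cast
  field_simp
  ring

/-! ### The deterministic step: a bounded `Q` keeps the curve away from `x` -/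

namespace Loewner

variable {W : ℝ≥0 → ℝ} {γ : ℝ≥0 → ℂ}

/-- **A bound on `Q` keeps the curve away from `x`** (Rohde–Schramm: "the distance from `x` to
`∂Dₜ` is at least `¼ (gₜ(x) - gₜ(y))/gₜ'(x)` … Hence it suffices to show `sup Q < ∞`"): if the
chain of `W` is generated by `γ`, `0 = W 0 < y < x`, `y` is never swallowed and
`log |gₜ'(x)| - log(gₜ(x) - gₜ(y)) ≤ L` for all `t`, then every `γ(s)` is at distance
`≥ e^{-L}/4` from `x` (`IsGeneratedByCurve.le_dist_apply_ofReal`), so `x ∉ cl γ[0, ∞)`.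
[cite: RohdeSchramm2005, proof of Lemma 7.2 (p. 909)] -/
theorem IsGeneratedByCurve.ofReal_notMem_closure_range_of_gap_bound (hW : Continuous W)
    (hγ : IsGeneratedByCurve W γ) {x y : ℝ} (hy : W 0 < y) (hyx : y < x)
    (hT : swallowingTime W y = ⊤) {L : ℝ}
    (hQ : ∀ t : ℝ≥0, Real.log ‖deriv (map W t) x‖ - Real.log ((map W t x).re - (map W t y).re) ≤ L) :
    (x : ℂ) ∉ closure (range γ) := by
  set ρ : ℝ := Real.exp (-L) / 4 with hρ
  have hρpos : 0 < ρ := by positivity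
  have hfar : ∀ s : ℝ≥0, ρ ≤ dist (γ s) x := by
    intro s
    have hTy : ((s : ℝ≥0) : WithTop ℝ≥0) < swallowingTime W y := by rw [hT]; exact WithTop.coe_lt_top s
    have hTx : ((s : ℝ≥0) : WithTop ℝ≥0) < swallowingTime W x :=
      lt_of_lt_of_le hTy (swallowingTime_mono_right hW hy hyx.le)
    have hkoebe := IsGeneratedByCurve.le_dist_apply_ofReal hW hy hTy hγ hyx (le_refl s)
    have hgap : 0 < (map W s x).re - (map W s y).re := sub_pos.2 (map_ofReal_re_lt_of_lt hW hy hyx hTy hTx)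
    have hder : 0 < ‖deriv (map W s) x‖ := norm_deriv_map_ofReal_pos hW (hy.trans hyx) hTx
    have hQ' := hQ s
    -- `gap/(4 g') = e^{log gap - log g'}/4 ≥ e^{-L}/4`
    have hratio : ρ ≤ ((map W s x).re - (map W s y).re) / (4 * ‖deriv (map W s) x‖) := by
      rw [hρ, div_le_div_iff₀ (by norm_num) (by positivity)]
      have h1 : Real.exp (-L) ≤ ((map W s x).re - (map W s y).re) / ‖deriv (map W s) x‖ := by
        rw [le_div_iff₀ hder, ← Real.exp_log hgap, ← Real.exp_log hder, ← Real.exp_add]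
        exact Real.exp_le_exp.2 (by linarith)
      rw [le_div_iff₀ hder] at h1
      nlinarith
    exact hratio.trans hkoebe
  rw [Metric.mem_closure_iff]
  push Not
  refine ⟨ρ, hρpos, ?_⟩
  rintro _ ⟨s, rfl⟩
  rw [dist_comm]
  exact hfar s

end Loewner

/-! ### The gap of the two flows: `log (X - Y) = log (x - y) - ∫ 2/(XY)` -/

section Gap

variable {x y : ℝ}

/-- **The logarithm of the gap**: for `0 < y < x` and `t < T_y`,
`log(X_t - Y_t) = log(x - y) - ∫₀ᵗ 2/(X_s Y_s) ds` (the gap solves `D' = 2/X - 2/Y = -2D/(XY)`).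
[folklore] -/
theorem log_gap_eq (hy : 0 < y) (hyx : y < x) {ω : ℝ≥0 → ℝ} {t : ℝ≥0}
    (ht : (t : WithTop ℝ≥0) < swallowingTime (sleDriving 4 ω) y) :
    Real.log (sleRealFlowStop 4 x t ω - sleRealFlowStop 4 y t ω) =
      Real.log (x - y) - ∫ s in (0 : ℝ)..t,
        2 / (sleRealFlowStop 4 x s.toNNReal ω * sleRealFlowStop 4 y s.toNNReal ω) := by
  have hx : 0 < x := hy.trans hyx
  set X : ℝ → ℝ := fun r ↦ sleRealFlowStop 4 x r.toNNReal ω with hX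
  set Y : ℝ → ℝ := fun r ↦ sleRealFlowStop 4 y r.toNNReal ω with hY
  have hXc : Continuous X := (continuous_sleRealFlowStop hx.ne' ω).comp continuous_real_toNNReal
  have hYc : Continuous Y := (continuous_sleRealFlowStop hy.ne' ω).comp continuous_real_toNNReal
  -- facts along `[0, t]`
  have hfacts : ∀ r ∈ Icc (0 : ℝ) t, 0 < Y r ∧ Y r < X r ∧
      X r - Y r = (x - y) + ∫ s in (0 : ℝ)..r, (2 / X s - 2 / Y s) := by
    intro r hr
    have hrt : ((r.toNNReal : ℝ≥0) : WithTop ℝ≥0) < swallowingTime (sleDriving 4 ω) y :=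
      lt_of_le_of_lt (WithTop.coe_le_coe.2 (Real.toNNReal_le_iff_le_coe.2 hr.2)) ht
    have h := sleRealFlowStop_sameSide_facts (κ := 4) hy hyx hrt
    simp only [hX, hY, Real.coe_toNNReal _ hr.1] at h ⊢
    exact h
  -- the global integrand `g = 2/X - 2/Y` and the gap `D = (x - y) + ∫ g`
  set g : ℝ → ℝ := fun s ↦ 2 / X s - 2 / Y s with hg
  have hgm : Measurable g := (measurable_const.div hXc.measurable).sub (measurable_const.div hYc.measurable)
  have hgc : ∀ r ∈ Icc (0 : ℝ) t, ContinuousAt g r := fun r hr ↦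
    (continuousAt_const.div hXc.continuousAt ((hfacts r hr).1.trans (hfacts r hr).2.1).ne').sub
      (continuousAt_const.div hYc.continuousAt (hfacts r hr).1.ne')
  have hgco : ContinuousOn g (Icc 0 t) := fun r hr ↦ (hgc r hr).continuousWithinAt
  set D : ℝ → ℝ := fun r ↦ (x - y) + ∫ s in (0 : ℝ)..r, g s with hD
  have hDeq : ∀ r ∈ Icc (0 : ℝ) t, X r - Y r = D r := fun r hr ↦ (hfacts r hr).2.2
  have hDpos : ∀ r ∈ Icc (0 : ℝ) t, 0 < D r := fun r hr ↦ by
    rw [← hDeq r hr]; linarith [(hfacts r hr).2.1]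
  have hDderiv : ∀ r ∈ Icc (0 : ℝ) t, HasDerivAt D (g r) r := by
    intro r hr
    have hint : IntervalIntegrable g volume 0 r :=
      (hgco.mono (by rw [uIcc_of_le hr.1]; exact Icc_subset_Icc_right hr.2)).intervalIntegrable
    exact (intervalIntegral.integral_hasDerivAt_right hint
      hgm.aestronglyMeasurable.stronglyMeasurableAtFilter (hgc r hr)).const_add (x - y)
  -- `log D` has derivative `-2/(XY)` on `[0, t]`
  have hlogderiv : ∀ r ∈ Icc (0 : ℝ) t, HasDerivAt (fun r ↦ Real.log (D r)) (-(2 / (X r * Y r))) r := by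
    intro r hr
    have h := (hDderiv r hr).log (hDpos r hr).ne'
    refine h.congr_deriv ?_
    rw [← hDeq r hr]
    obtain ⟨hYp, hYX, -⟩ := hfacts r hr
    have hXp : 0 < X r := hYp.trans hYX
    have hdne : X r - Y r ≠ 0 := by linarith
    simp only [hg]
    field_simp
    ring
  have hrate_c : ContinuousOn (fun r ↦ -(2 / (X r * Y r))) (Icc 0 t) := fun r hr ↦
    (continuousAt_const.div (hXc.continuousAt.mul hYc.continuousAt)
      (mul_ne_zero ((hfacts r hr).1.trans (hfacts r hr).2.1).ne' (hfacts r hr).1.ne')).neg.continuousWithinAt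
  have hFTC := intervalIntegral.integral_eq_sub_of_hasDerivAt
    (f := fun r ↦ Real.log (D r)) (f' := fun r ↦ -(2 / (X r * Y r)))
    (fun r hr ↦ hlogderiv r (by rwa [uIcc_of_le t.coe_nonneg] at hr))
    (hrate_c.intervalIntegrable_of_Icc t.coe_nonneg)
  -- assemble
  have hD0 : D 0 = x - y := by simp [hD]
  have hDt : Real.log (D t) = Real.log (X t - Y t) := by rw [hDeq t ⟨t.coe_nonneg, le_rfl⟩]
  have hXt : X t = sleRealFlowStop 4 x t ω := by simp [hX]
  have hYt : Y t = sleRealFlowStop 4 y t ω := by simp [hY]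
  simp only [intervalIntegral.integral_neg, hDt, hD0, hXt, hYt] at hFTC
  have hXY : ∀ s : ℝ, X s * Y s = sleRealFlowStop 4 x s.toNNReal ω * sleRealFlowStop 4 y s.toNNReal ω :=
    fun s ↦ rfl
  simp only [hXY] at hFTC
  linarith

end Gap

/-! ### The Itô step: `E ∫₀^{N∧ρ} q ≤ 4` -/

section Stopped

variable {x y : ℝ}

variable (x y) in
/-- The **stopped functional `∫₀^{N∧ρ} q(X_s, Y_s) ds`**, `ρ` the same-side stopping time of
`SLESameSideMartingale` (κ = 4). [cite: RohdeSchramm2005, proof of Lemma 7.2 (p. 909)] -/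
def sleKappaFourStopped (δ₀ R δ₁ R₁ : ℝ) (N : ℝ≥0) (ω : ℝ≥0 → ℝ) : ℝ :=
  timeIntegral (trunc (sleSameSideTime 4 x y δ₀ R δ₁ R₁) fun s ω ↦
    kappaFourRate (sleRealFlowStop 4 x s ω) (sleRealFlowStop 4 y s ω)) N ω

/-- **`E ∫₀^{N∧ρ} q ≤ 4`, the functional being non-negative and integrable.** With a `C²`
function `f` equal to `G̃` on `[1 + δ₀, 1 + R]`, `f(Z_{t∧ρ}) - ∫₀^{t∧ρ} q` is a martingale
(`martingale_apply_sameSideRatio_sub_timeIntegral`, the drift being `q` by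
`sameSideItoDrift_four_eq_rate`), started at `G̃(x/(x-y))`, and `|G̃| ≤ 2`.
[cite: RohdeSchramm2005, proof of Lemma 7.2 (p. 909)] -/
theorem integral_sleKappaFourStopped_le (hy : 0 < y) (hyx : y < x) {δ₀ R δ₁ R₁ : ℝ}
    (hδ₀ : 0 < δ₀) (hz₀ : 1 + δ₀ < x / (x - y)) (hz₀' : x / (x - y) < 1 + R)
    (hδ₁ : 0 < δ₁) (hδ₁y : δ₁ < y) (hyR₁ : y < R₁) (N : ℝ≥0) :
    Integrable (sleKappaFourStopped x y δ₀ R δ₁ R₁ N) preWienerMeasure ∧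
      (∀ ω, 0 ≤ sleKappaFourStopped x y δ₀ R δ₁ R₁ N ω) ∧
      ∫ ω, sleKappaFourStopped x y δ₀ R δ₁ R₁ N ω ∂preWienerMeasure ≤ 4 := by
  haveI := isProbabilityMeasure_preWienerMeasure'
  have hx : 0 < x := hy.trans hyx
  have hz1 : 1 < 1 + δ₀ := by linarith
  -- a `C²` function equal to `G̃` near `[1+δ₀, 1+R]`
  obtain ⟨f, hf, hfeq, -⟩ := exists_contDiff_eqOn_Icc (n := 2) (a := 1) (b := R + 3) (lo := 1 + δ₀ / 2)
    (hi := R + 2) (by linarith) (by linarith [hz₀.trans hz₀']) (by linarith)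
    (contDiffOn_two_kappaFourG.mono fun z hz ↦ (show (1 : ℝ) < z from hz.1))
  have hfnhds : ∀ z ∈ Icc (1 + δ₀) (1 + R), f =ᶠ[𝓝 z] kappaFourG := by
    intro z hz
    have hmem : Ioo (1 + δ₀ / 2) (R + 2) ∈ 𝓝 z := Ioo_mem_nhds (by linarith [hz.1]) (by linarith [hz.2])
    filter_upwards [hmem] with u hu
    exact hfeq (Ioo_subset_Icc_self hu)
  have hzgt : ∀ z ∈ Icc (1 + δ₀) (1 + R), 1 < z := fun z hz ↦ lt_of_lt_of_le hz1 hz.1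
  have hf1 : ∀ z ∈ Icc (1 + δ₀) (1 + R), deriv f z = kappaFourKernel z := by
    intro z hz
    rw [(hfnhds z hz).deriv_eq]
    exact deriv_kappaFourG (hzgt z hz)
  have hf2 : ∀ z ∈ Icc (1 + δ₀) (1 + R), iteratedDeriv 2 f z = kappaFourKernelDeriv z := by
    intro z hz
    rw [iteratedDeriv_succ, iteratedDeriv_one]
    have h1 : deriv f =ᶠ[𝓝 z] kappaFourKernel := by
      have hmem : Ioi (1 : ℝ) ∈ 𝓝 z := Ioi_mem_nhds (hzgt z hz)
      filter_upwards [(hfnhds z hz).deriv, hmem] with u hu hu'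
      rw [hu]
      exact deriv_kappaFourG hu'
    rw [h1.deriv_eq]
    exact deriv_kappaFourKernel (hzgt z hz)
  have hmart := martingale_apply_sameSideRatio_sub_timeIntegral (κ := 4) (by norm_num) hy hyx hδ₀ hz₀ hz₀'
    hδ₁ hδ₁y hyR₁ hf
  set ρ := sleSameSideTime 4 x y δ₀ R δ₁ R₁ with hρ
  set Zρ : ℝ≥0 → (ℝ≥0 → ℝ) → ℝ := fun t ω ↦ stoppedProcess (sleRealFlowStop 4 x) ρ t ω /
    (stoppedProcess (sleRealFlowStop 4 x) ρ t ω - stoppedProcess (sleRealFlowStop 4 y) ρ t ω) with hZρ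
  have hbounds : ∀ (ω : ℝ≥0 → ℝ) (t : ℝ≥0), (t : WithTop ℝ≥0) ≤ ρ ω →
      δ₁ ≤ sleRealFlowStop 4 y t ω ∧ sleRealFlowStop 4 y t ω < sleRealFlowStop 4 x t ω ∧
      sleRealFlowStop 4 x t ω / (sleRealFlowStop 4 x t ω - sleRealFlowStop 4 y t ω) ∈ Icc (1 + δ₀) (1 + R) :=
    fun ω t ht ↦ by
      have h := sleSameSide_bounds_of_le (κ := 4) hy hyx hδ₀ hz₀ hz₀' hδ₁ hδ₁y hyR₁ ht
      exact ⟨h.2.1, h.2.2.1, h.2.2.2.1⟩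
  -- the drift is the rate `q`
  have hdrift : (trunc ρ fun s ω ↦ sameSideItoDrift 4 f (sleRealFlowStop 4 x s ω) (sleRealFlowStop 4 y s ω)) =
      trunc ρ fun s ω ↦ kappaFourRate (sleRealFlowStop 4 x s ω) (sleRealFlowStop 4 y s ω) := by
    funext s ω
    by_cases hs : (s : WithTop ℝ≥0) ≤ ρ ω
    · rw [trunc_of_le hs, trunc_of_le hs]
      obtain ⟨hY, hYX, hZ⟩ := hbounds ω s hs
      exact sameSideItoDrift_four_eq_rate (hδ₁.trans_le hY) hYX (hf1 _ hZ) (hf2 _ hZ)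
    · rw [trunc_of_not_le hs, trunc_of_not_le hs]
  rw [hdrift] at hmart
  -- `hmart : Martingale (fun t ω ↦ f (Zρ t ω) - A t ω)`
  have hZmem : ∀ t ω, Zρ t ω ∈ Icc (1 + δ₀) (1 + R) := by
    intro t ω
    have h := (hbounds ω _ (coe_untopA_min_le t (ρ ω))).2.2
    simpa only [hZρ, stoppedProcess] using h
  have hO : ∀ t ω, f (Zρ t ω) = kappaFourG (Zρ t ω) := fun t ω ↦
    hfeq ⟨by linarith [(hZmem t ω).1], by linarith [(hZmem t ω).2]⟩
  have hfbd : ∀ t ω, |f (Zρ t ω)| ≤ 2 := fun t ω ↦ by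
    rw [hO t ω]; exact abs_kappaFourG_le (hzgt _ (hZmem t ω))
  -- measurability and integrability of `f (Zρ N)`
  have hfm : Measurable fun ω ↦ f (Zρ N ω) := by
    have hρst : IsStoppingTime brownianFiltration ρ :=
      isStoppingTime_sleSameSideTime (κ := 4) hy hyx hδ₁ hδ₁y hyR₁ δ₀ R
    have hmx : Measurable (stoppedProcess (sleRealFlowStop 4 x) ρ N) :=
      (((isStronglyProgressive_sleRealFlowStop 4 hx.ne').stronglyAdapted_stoppedProcess hρst) N).measurable.mono
        (brownianFiltration.le N) le_rfl
    have hmy : Measurable (stoppedProcess (sleRealFlowStop 4 y) ρ N) :=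
      (((isStronglyProgressive_sleRealFlowStop 4 hy.ne').stronglyAdapted_stoppedProcess hρst) N).measurable.mono
        (brownianFiltration.le N) le_rfl
    exact hf.continuous.measurable.comp (hmx.div (hmx.sub hmy))
  have hfint : Integrable (fun ω ↦ f (Zρ N ω)) preWienerMeasure :=
    Integrable.of_bound hfm.aestronglyMeasurable 2 (ae_of_all _ fun ω ↦ by
      rw [Real.norm_eq_abs]; exact hfbd N ω)
  have hMint : Integrable (fun ω ↦ f (Zρ N ω) - sleKappaFourStopped x y δ₀ R δ₁ R₁ N ω) preWienerMeasure :=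
    hmart.integrable N
  have hAeq : sleKappaFourStopped x y δ₀ R δ₁ R₁ N = fun ω ↦
      f (Zρ N ω) - (f (Zρ N ω) - sleKappaFourStopped x y δ₀ R δ₁ R₁ N ω) := by
    funext ω; ring
  have hAint : Integrable (sleKappaFourStopped x y δ₀ R δ₁ R₁ N) preWienerMeasure := by
    rw [hAeq]; exact hfint.sub hMint
  -- non-negativity
  have hAnn : ∀ ω, 0 ≤ sleKappaFourStopped x y δ₀ R δ₁ R₁ N ω := by
    intro ω
    simp only [sleKappaFourStopped, timeIntegral]
    refine intervalIntegral.integral_nonneg N.coe_nonneg fun s _ ↦ ?_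
    by_cases hs : ((s.toNNReal : ℝ≥0) : WithTop ℝ≥0) ≤ ρ ω
    · rw [trunc_of_le hs]
      obtain ⟨hY, hYX, -⟩ := hbounds ω _ hs
      exact kappaFourRate_nonneg (hδ₁.trans_le hY) hYX.le
    · rw [trunc_of_not_le hs]
  -- the expectation
  have hE : ∫ ω, (f (Zρ N ω) - sleKappaFourStopped x y δ₀ R δ₁ R₁ N ω) ∂preWienerMeasure =
      kappaFourG (x / (x - y)) := by
    have h1 := integral_eq_of_martingale hmart N
    have h0 : ∀ ω, f (stoppedProcess (sleRealFlowStop 4 x) ρ 0 ω /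
        (stoppedProcess (sleRealFlowStop 4 x) ρ 0 ω - stoppedProcess (sleRealFlowStop 4 y) ρ 0 ω)) -
        timeIntegral (trunc ρ fun s ω ↦ kappaFourRate (sleRealFlowStop 4 x s ω) (sleRealFlowStop 4 y s ω)) 0 ω =
        kappaFourG (x / (x - y)) := by
      intro ω
      have hz : x / (x - y) ∈ Icc (1 + δ₀) (1 + R) := ⟨hz₀.le, hz₀'.le⟩
      simp only [stoppedProcess, untopA_min_zero, sleRealFlowStop_zero_apply hx.ne',
        sleRealFlowStop_zero_apply hy.ne', timeIntegral_apply_zero, sub_zero]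
      exact hfeq ⟨by linarith [hz.1], by linarith [hz.2]⟩
    simp only [h0, integral_const, smul_eq_mul, probReal_univ, one_mul] at h1
    exact h1
  refine ⟨hAint, hAnn, ?_⟩
  have h2 : ∫ ω, sleKappaFourStopped x y δ₀ R δ₁ R₁ N ω ∂preWienerMeasure =
      ∫ ω, f (Zρ N ω) ∂preWienerMeasure - kappaFourG (x / (x - y)) := by
    rw [← hE, ← integral_sub hfint hMint]
    simp only [sub_sub_cancel]
  rw [h2]
  have h3 : ∫ ω, f (Zρ N ω) ∂preWienerMeasure ≤ 2 := by
    have := integral_mono hfint (integrable_const (2 : ℝ)) fun ω ↦ (le_abs_self _).trans (hfbd N ω)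
    simpa only [integral_const, smul_eq_mul, probReal_univ, one_mul] using this
  have h4 : -2 ≤ kappaFourG (x / (x - y)) :=
    (abs_le.1 (abs_kappaFourG_le (hz1.trans hz₀))).1
  linarith

/-- **Markov's inequality for the stopped functional**: `P[λ ≤ ∫₀^{N∧ρ} q] ≤ 4/λ`.
[cite: RohdeSchramm2005, proof of Lemma 7.2 (p. 909)] -/
theorem measureReal_le_sleKappaFourStopped_le (hy : 0 < y) (hyx : y < x) {δ₀ R δ₁ R₁ : ℝ}
    (hδ₀ : 0 < δ₀) (hz₀ : 1 + δ₀ < x / (x - y)) (hz₀' : x / (x - y) < 1 + R)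
    (hδ₁ : 0 < δ₁) (hδ₁y : δ₁ < y) (hyR₁ : y < R₁) (N : ℝ≥0) {lam : ℝ} (hlam : 0 < lam) :
    preWienerMeasure.real {ω | lam ≤ sleKappaFourStopped x y δ₀ R δ₁ R₁ N ω} ≤ 4 / lam := by
  haveI := isProbabilityMeasure_preWienerMeasure'
  obtain ⟨hint, hnn, hE⟩ := integral_sleKappaFourStopped_le hy hyx hδ₀ hz₀ hz₀' hδ₁ hδ₁y hyR₁ N
  have hmarkov := mul_meas_ge_le_integral_of_nonneg (ae_of_all _ hnn) hint lam
  rw [le_div_iff₀ hlam, mul_comm]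
  exact hmarkov.trans hE

/-! ### The raw functional and the box events -/

variable (x y) in
/-- The **raw functional `∫₀ᵗ q(X_s, Y_s) ds`** of the two frozen flows (no stopping); on
`{T_y = ∞}` it is `Q(t) + log(x - y)`. [cite: RohdeSchramm2005, proof of Lemma 7.2 (p. 909)] -/
def sleKappaFourRaw (t : ℝ≥0) (ω : ℝ≥0 → ℝ) : ℝ :=
  ∫ s in (0 : ℝ)..t, kappaFourRate (sleRealFlowStop 4 x s.toNNReal ω) (sleRealFlowStop 4 y s.toNNReal ω)

/-- On `{T_y = ∞}` the rate along the flows is non-negative and continuous, so the raw functional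
is non-decreasing. [folklore] -/
theorem sleKappaFourRaw_mono (hy : 0 < y) (hyx : y < x) {ω : ℝ≥0 → ℝ}
    (hT : swallowingTime (sleDriving 4 ω) y = ⊤) {t t' : ℝ≥0} (htt' : t ≤ t') :
    sleKappaFourRaw x y t ω ≤ sleKappaFourRaw x y t' ω := by
  have hx : 0 < x := hy.trans hyx
  have hpos : ∀ s : ℝ≥0, 0 < sleRealFlowStop 4 y s ω ∧ sleRealFlowStop 4 y s ω < sleRealFlowStop 4 x s ω :=
    fun s ↦ by
      have h := sleRealFlowStop_sameSide_facts (κ := 4) hy hyx (t := s) (by rw [hT]; exact WithTop.coe_lt_top s)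
      exact ⟨h.1, h.2.1⟩
  have hnn : ∀ r : ℝ, 0 ≤ kappaFourRate (sleRealFlowStop 4 x r.toNNReal ω) (sleRealFlowStop 4 y r.toNNReal ω) :=
    fun r ↦ kappaFourRate_nonneg (hpos _).1 (hpos _).2.le
  have hc : Continuous fun r : ℝ ↦
      kappaFourRate (sleRealFlowStop 4 x r.toNNReal ω) (sleRealFlowStop 4 y r.toNNReal ω) := by
    have hX := (continuous_sleRealFlowStop (κ := 4) hx.ne' ω).comp continuous_real_toNNReal
    have hY := (continuous_sleRealFlowStop (κ := 4) hy.ne' ω).comp continuous_real_toNNReal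
    simp only [kappaFourRate]
    refine (continuous_const.div (hX.mul hY) fun r ↦ mul_ne_zero ((hpos _).1.trans (hpos _).2).ne'
      (hpos _).1.ne').sub (continuous_const.div (hX.pow 2) fun r ↦ (pow_pos ((hpos _).1.trans (hpos _).2) 2).ne')
  exact intervalIntegral.integral_mono_interval le_rfl t.coe_nonneg (NNReal.coe_le_coe.2 htt')
    (Eventually.of_forall hnn) (hc.intervalIntegrable _ _)

/-- **The stopped functional is the raw one when the flows stay in the box on `[0, N]`**: if
`Y_s ∈ (δ₁, R₁)` and `X_s/(X_s - Y_s) ∈ (1 + δ₀, 1 + R)` for `s ≤ N`, then `N < ρ` and the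
truncations are trivial on `[0, N]`. [folklore] -/
theorem sleKappaFourStopped_eq_raw (hy : 0 < y) (hyx : y < x) {δ₀ R δ₁ R₁ : ℝ}
    (hδ₁ : 0 < δ₁) (hδ₁y : δ₁ < y) (hyR₁ : y < R₁) {ω : ℝ≥0 → ℝ} {N : ℝ≥0}
    (hin : ∀ s : ℝ≥0, s ≤ N → sleRealFlowStop 4 y s ω ∈ Ioo δ₁ R₁ ∧
      sleRealFlowStop 4 x s ω / (sleRealFlowStop 4 x s ω - sleRealFlowStop 4 y s ω) ∈ Ioo (1 + δ₀) (1 + R)) :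
    sleKappaFourStopped x y δ₀ R δ₁ R₁ N ω = sleKappaFourRaw x y N ω := by
  have hx : 0 < x := hy.trans hyx
  -- `N < τ` (exit of `Y`)
  have hNτ : (N : WithTop ℝ≥0) < exitTime (sleRealFlowStop 4 y) δ₁ R₁ ω := by
    by_contra hle
    rw [not_lt, exitTime_le_coe_iff (continuous_sleRealFlowStop hy.ne' ω)] at hle
    obtain ⟨j, hj, hout⟩ := hle
    exact hout (hin j hj).1
  -- up to `N` the ratio process is the ratio
  have hratio : ∀ s : ℝ≥0, s ≤ N → sleSameSideRatio 4 x y δ₁ R₁ s ω =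
      sleRealFlowStop 4 x s ω / (sleRealFlowStop 4 x s ω - sleRealFlowStop 4 y s ω) := by
    intro s hs
    have hsτ : (s : WithTop ℝ≥0) ≤ exitTime (sleRealFlowStop 4 y) δ₁ R₁ ω :=
      (WithTop.coe_le_coe.2 hs).trans hNτ.le
    simp only [sleSameSideRatio, stoppedProcess_eq_of_le hsτ]
  have hNZ : (N : WithTop ℝ≥0) < exitTime (sleSameSideRatio 4 x y δ₁ R₁) (1 + δ₀) (1 + R) ω := by
    by_contra hle
    rw [not_lt, exitTime_le_coe_iff (continuous_sleSameSideRatio hy hyx hδ₁ hδ₁y hyR₁ ω)] at hle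
    obtain ⟨j, hj, hout⟩ := hle
    rw [hratio j hj] at hout
    exact hout (hin j hj).2
  have hNρ : (N : WithTop ℝ≥0) < sleSameSideTime 4 x y δ₀ R δ₁ R₁ ω := lt_min hNτ hNZ
  have hle : ∀ s ∈ uIcc (0 : ℝ) N, ((s.toNNReal : ℝ≥0) : WithTop ℝ≥0) ≤ sleSameSideTime 4 x y δ₀ R δ₁ R₁ ω := by
    intro s hs
    rw [uIcc_of_le N.coe_nonneg] at hs
    exact (WithTop.coe_le_coe.2 (Real.toNNReal_le_iff_le_coe.2 hs.2)).trans hNρ.le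
  simp only [sleKappaFourStopped, sleKappaFourRaw, timeIntegral]
  refine intervalIntegral.integral_congr fun s hs ↦ ?_
  simp only [trunc_of_le (hle s hs)]

variable (x y) in
/-- The event "**on `[0, N]`, `Y ∈ (y/(m+2), y+m+1)` and `X/(X-Y) ∈ (1 + (z₀-1)/(m+2), z₀+m+1)`**",
`z₀ = x/(x-y)` (increasing in `m`, exhausting `{T_y = ∞}`). [folklore] -/
def sleKappaFourBox (N : ℝ≥0) (m : ℕ) : Set (ℝ≥0 → ℝ) :=
  {ω | ∀ s : ℝ≥0, s ≤ N → sleRealFlowStop 4 y s ω ∈ Ioo (y / (m + 2)) (y + m + 1) ∧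
    sleRealFlowStop 4 x s ω / (sleRealFlowStop 4 x s ω - sleRealFlowStop 4 y s ω) ∈
      Ioo (1 + (x / (x - y) - 1) / (m + 2)) (x / (x - y) + m + 1)}

/-- The boxes increase with `m`. [folklore] -/
theorem monotone_sleKappaFourBox (hy : 0 < y) (hyx : y < x) (N : ℝ≥0) :
    Monotone (sleKappaFourBox x y N) := by
  have hz₀ : 1 < x / (x - y) := by
    rw [lt_div_iff₀ (by linarith)]; linarith
  refine monotone_nat_of_le_succ fun m ω hω s hs ↦ ?_
  obtain ⟨⟨h1, h2⟩, h3, h4⟩ := hω s hs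
  have hm : (0 : ℝ) < m + 2 := by positivity
  have hδ : y / ((m + 1 : ℕ) + 2) ≤ y / (m + 2) := by
    push_cast
    exact div_le_div_of_nonneg_left hy.le hm (by linarith)
  have hδ' : (x / (x - y) - 1) / ((m + 1 : ℕ) + 2) ≤ (x / (x - y) - 1) / (m + 2) := by
    push_cast
    exact div_le_div_of_nonneg_left (by linarith) hm (by linarith)
  refine ⟨⟨hδ.trans_lt h1, ?_⟩, lt_of_le_of_lt (by linarith) h3, ?_⟩
  · push_cast; linarith
  · push_cast; linarith

/-- **On `{T_y = ∞}` the flows stay in some box on `[0, N]`** (continuity on a compact interval: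
`Y > 0` and `X/(X-Y) > 1` there). [folklore] -/
theorem exists_mem_sleKappaFourBox (hy : 0 < y) (hyx : y < x) {ω : ℝ≥0 → ℝ}
    (hT : swallowingTime (sleDriving 4 ω) y = ⊤) (N : ℝ≥0) : ∃ m, ω ∈ sleKappaFourBox x y N m := by
  have hx : 0 < x := hy.trans hyx
  set X := fun s : ℝ≥0 ↦ sleRealFlowStop 4 x s ω with hX
  set Y := fun s : ℝ≥0 ↦ sleRealFlowStop 4 y s ω with hY
  have hpos : ∀ s : ℝ≥0, 0 < Y s ∧ Y s < X s := fun s ↦ by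
    have h := sleRealFlowStop_sameSide_facts (κ := 4) hy hyx (t := s) (by rw [hT]; exact WithTop.coe_lt_top s)
    exact ⟨h.1, h.2.1⟩
  have hYc : Continuous Y := continuous_sleRealFlowStop hy.ne' ω
  have hXc : Continuous X := continuous_sleRealFlowStop hx.ne' ω
  set Zf := fun s : ℝ≥0 ↦ X s / (X s - Y s) with hZf
  have hZc : Continuous Zf := hXc.div (hXc.sub hYc) fun s ↦ (sub_pos.2 (hpos s).2).ne'
  have hZgt : ∀ s, 1 < Zf s := fun s ↦ by
    obtain ⟨h1, h2⟩ := hpos s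
    simp only [hZf]
    rw [lt_div_iff₀ (by linarith)]; linarith
  have hK : IsCompact (Icc (0 : ℝ≥0) N) := isCompact_Icc
  have hne : (Icc (0 : ℝ≥0) N).Nonempty := ⟨0, left_mem_Icc.2 bot_le⟩
  obtain ⟨s₀, -, hYmin⟩ := hK.exists_isMinOn hne hYc.continuousOn
  obtain ⟨s₁, -, hYmax⟩ := hK.exists_isMaxOn hne hYc.continuousOn
  obtain ⟨s₂, -, hZmin⟩ := hK.exists_isMinOn hne hZc.continuousOn
  obtain ⟨s₃, -, hZmax⟩ := hK.exists_isMaxOn hne hZc.continuousOn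
  have hy₀pos : 0 < Y s₀ := (hpos s₀).1
  have hz₂ : 1 < Zf s₂ := hZgt s₂
  set z₀ : ℝ := x / (x - y) with hz₀
  have hz₀gt : 1 < z₀ := by rw [hz₀, lt_div_iff₀ (by linarith)]; linarith
  -- choose `m`
  obtain ⟨m₁, hm₁⟩ := exists_nat_gt (y / Y s₀)
  obtain ⟨m₂, hm₂⟩ := exists_nat_gt (Y s₁ - y)
  obtain ⟨m₃, hm₃⟩ := exists_nat_gt ((z₀ - 1) / (Zf s₂ - 1))
  obtain ⟨m₄, hm₄⟩ := exists_nat_gt (Zf s₃ - z₀)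
  set m : ℕ := max (max m₁ m₂) (max m₃ m₄) with hm
  have hm₁' : (m₁ : ℝ) ≤ m := by exact_mod_cast (le_max_left _ _).trans (le_max_left _ _)
  have hm₂' : (m₂ : ℝ) ≤ m := by exact_mod_cast (le_max_right _ _).trans (le_max_left _ _)
  have hm₃' : (m₃ : ℝ) ≤ m := by exact_mod_cast (le_max_left _ _).trans (le_max_right _ _)
  have hm₄' : (m₄ : ℝ) ≤ m := by exact_mod_cast (le_max_right _ _).trans (le_max_right _ _)
  refine ⟨m, fun s hs ↦ ?_⟩
  have hsmem : s ∈ Icc (0 : ℝ≥0) N := ⟨bot_le, hs⟩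
  have hYlo : Y s₀ ≤ Y s := hYmin hsmem
  have hYhi : Y s ≤ Y s₁ := hYmax hsmem
  have hZlo : Zf s₂ ≤ Zf s := hZmin hsmem
  have hZhi : Zf s ≤ Zf s₃ := hZmax hsmem
  have hmpos : (0 : ℝ) < m + 2 := by positivity
  refine ⟨⟨?_, ?_⟩, ?_, ?_⟩
  · -- `y/(m+2) < Y s`
    have h1 : y / Y s₀ < m + 2 := by linarith
    rw [div_lt_iff₀ hy₀pos] at h1
    rw [div_lt_iff₀ hmpos]
    nlinarith
  · show Y s < y + m + 1
    linarith
  · -- `1 + (z₀-1)/(m+2) < Zf s`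
    show 1 + (z₀ - 1) / (m + 2) < X s / (X s - Y s)
    have hZs : Zf s = X s / (X s - Y s) := rfl
    rw [← hZs]
    have h1 : (z₀ - 1) / (Zf s₂ - 1) < m + 2 := by linarith
    rw [div_lt_iff₀ (by linarith)] at h1
    have h2 : (z₀ - 1) / (m + 2) < Zf s₂ - 1 := by
      rw [div_lt_iff₀ hmpos]; linarith
    linarith
  · show X s / (X s - Y s) < z₀ + m + 1
    have hZs : Zf s = X s / (X s - Y s) := rfl
    rw [← hZs]
    linarith

/-- **Tail bound for the raw functional**: for `0 < y < x`, `λ > 0` and every `N`,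
`P[{λ ≤ ∫₀ᴺ q} ∩ {T_y = ∞}] ≤ 4/λ` (on the box events the raw functional is the stopped one;
Markov; the boxes increase to cover `{T_y = ∞}`). [cite: RohdeSchramm2005, proof of Lemma 7.2 (p. 909)] -/
theorem measure_le_sleKappaFourRaw_le (hy : 0 < y) (hyx : y < x) (N : ℝ≥0) {lam : ℝ} (hlam : 0 < lam) :
    preWienerMeasure ({ω | lam ≤ sleKappaFourRaw x y N ω} ∩ {ω | swallowingTime (sleDriving 4 ω) y = ⊤}) ≤
      ENNReal.ofReal (4 / lam) := by
  haveI := isProbabilityMeasure_preWienerMeasure'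
  have hxy : 0 < x - y := by linarith
  set z₀ : ℝ := x / (x - y) with hz₀
  have hz₀gt : 1 < z₀ := by rw [hz₀, lt_div_iff₀ hxy]; linarith
  set S : ℕ → Set (ℝ≥0 → ℝ) := fun m ↦ {ω | lam ≤ sleKappaFourRaw x y N ω} ∩ sleKappaFourBox x y N m with hS
  have hSmono : Monotone S := fun m m' h ω hω ↦ ⟨hω.1, monotone_sleKappaFourBox hy hyx N h hω.2⟩
  have hSm : ∀ m, preWienerMeasure (S m) ≤ ENNReal.ofReal (4 / lam) := by
    intro m
    have hmpos : (0 : ℝ) < m + 2 := by positivity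
    set δ₁ : ℝ := y / (m + 2) with hδ₁
    set R₁ : ℝ := y + m + 1 with hR₁
    set δ₀ : ℝ := (z₀ - 1) / (m + 2) with hδ₀
    set R : ℝ := z₀ + m with hR
    have hδ₁pos : 0 < δ₁ := by positivity
    have hδ₁y : δ₁ < y := by rw [hδ₁, div_lt_iff₀ hmpos]; nlinarith
    have hyR₁ : y < R₁ := by rw [hR₁]; linarith [m.cast_nonneg (α := ℝ)]
    have hδ₀pos : 0 < δ₀ := by rw [hδ₀]; exact div_pos (by linarith) hmpos
    have hz₀' : 1 + δ₀ < x / (x - y) := by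
      rw [← hz₀, hδ₀]
      have : (z₀ - 1) / (m + 2) < z₀ - 1 := by
        rw [div_lt_iff₀ hmpos]; nlinarith [m.cast_nonneg (α := ℝ)]
      linarith
    have hz₀'' : x / (x - y) < 1 + R := by rw [← hz₀, hR]; linarith [m.cast_nonneg (α := ℝ)]
    have hsub : S m ⊆ {ω | lam ≤ sleKappaFourStopped x y δ₀ R δ₁ R₁ N ω} := by
      rintro ω ⟨hω, hbox⟩
      show lam ≤ _
      rw [sleKappaFourStopped_eq_raw hy hyx hδ₁pos hδ₁y hyR₁ (δ₀ := δ₀) (R := R) (fun s hs ↦ ?_)]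
      · exact hω
      · have h := hbox s hs
        refine ⟨h.1, ?_⟩
        have : 1 + R = z₀ + m + 1 := by rw [hR]; ring
        rw [this]
        exact h.2
    have h := measureReal_le_sleKappaFourStopped_le hy hyx hδ₀pos hz₀' hz₀'' hδ₁pos hδ₁y hyR₁ N hlam
    calc preWienerMeasure (S m)
        ≤ preWienerMeasure {ω | lam ≤ sleKappaFourStopped x y δ₀ R δ₁ R₁ N ω} := measure_mono hsub
      _ = ENNReal.ofReal (preWienerMeasure.real {ω | lam ≤ sleKappaFourStopped x y δ₀ R δ₁ R₁ N ω}) :=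
          (ENNReal.ofReal_toReal (measure_ne_top _ _)).symm
      _ ≤ ENNReal.ofReal (4 / lam) := ENNReal.ofReal_le_ofReal h
  have hcover : {ω | lam ≤ sleKappaFourRaw x y N ω} ∩ {ω | swallowingTime (sleDriving 4 ω) y = ⊤} ⊆ ⋃ m, S m := by
    rintro ω ⟨hω, hT⟩
    obtain ⟨m, hm⟩ := exists_mem_sleKappaFourBox hy hyx hT N
    exact mem_iUnion.2 ⟨m, hω, hm⟩
  refine (measure_mono hcover).trans ?_
  exact le_of_tendsto' (tendsto_measure_iUnion_atTop hSmono) hSm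

/-- **For `0 < y < x`, almost surely `sup_t ∫₀ᵗ q(X_s, Y_s) ds < ∞`** (`κ = 4`): `y` is a.s. never
swallowed (`ae_sle_swallowingTime_eq_top_of_le_four`), the raw functional is non-decreasing, and
`P[sup ≥ L] ≤ 4/L` for every `L` (`measure_le_sleKappaFourRaw_le`). This is "`sup_t Q(t) < ∞`
a.s." of Rohde–Schramm's proof of Lemma 7.2 at `κ = 4` (p. 909).
[cite: RohdeSchramm2005, proof of Lemma 7.2 (p. 909)] -/
theorem ae_exists_forall_sleKappaFourRaw_le (hy : 0 < y) (hyx : y < x) :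
    ∀ᵐ ω ∂preWienerMeasure, ∃ L : ℝ, ∀ t : ℝ≥0, sleKappaFourRaw x y t ω ≤ L := by
  haveI := isProbabilityMeasure_preWienerMeasure'
  set G : Set (ℝ≥0 → ℝ) := {ω | swallowingTime (sleDriving 4 ω) y = ⊤} with hG
  have hGae : ∀ᵐ ω ∂preWienerMeasure, ω ∈ G :=
    ae_sle_swallowingTime_eq_top_of_le_four (κ := 4) (by norm_num) le_rfl hy
  set Bad : Set (ℝ≥0 → ℝ) := {ω | ω ∈ G ∧ ∀ L : ℕ, ∃ N : ℕ, (L : ℝ) + 1 ≤ sleKappaFourRaw x y N ω} with hBad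
  have hBadle : ∀ L : ℕ, preWienerMeasure Bad ≤ ENNReal.ofReal (4 / ((L : ℝ) + 1)) := by
    intro L
    set E : ℕ → Set (ℝ≥0 → ℝ) := fun N ↦ {ω | (L : ℝ) + 1 ≤ sleKappaFourRaw x y N ω} ∩ G with hE
    have hEmono : Monotone E := by
      refine monotone_nat_of_le_succ fun N ω hω ↦ ⟨?_, hω.2⟩
      exact le_trans hω.1 (sleKappaFourRaw_mono hy hyx hω.2 (by exact_mod_cast N.le_succ))
    have hsub : Bad ⊆ ⋃ N, E N := by
      rintro ω ⟨hωG, hω⟩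
      obtain ⟨N, hN⟩ := hω L
      exact mem_iUnion.2 ⟨N, hN, hωG⟩
    refine (measure_mono hsub).trans (le_of_tendsto' (tendsto_measure_iUnion_atTop hEmono) fun N ↦ ?_)
    exact measure_le_sleKappaFourRaw_le hy hyx N (by positivity)
  have hBad0 : preWienerMeasure Bad = 0 := by
    have hlim : Tendsto (fun L : ℕ ↦ ENNReal.ofReal (4 / ((L : ℝ) + 1))) atTop (𝓝 0) := by
      rw [← ENNReal.ofReal_zero]
      refine ENNReal.tendsto_ofReal ?_
      have h := tendsto_one_div_add_atTop_nhds_zero_nat.const_mul (4 : ℝ)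
      rw [mul_zero] at h
      refine h.congr fun L ↦ ?_
      ring
    exact le_antisymm (ge_of_tendsto' hlim hBadle) bot_le
  filter_upwards [hGae, measure_eq_zero_iff_ae_notMem.1 hBad0] with ω hωG hωBad
  have h : ∃ L : ℕ, ∀ N : ℕ, sleKappaFourRaw x y N ω < (L : ℝ) + 1 := by
    by_contra hcon
    push Not at hcon
    exact hωBad ⟨hωG, hcon⟩
  obtain ⟨L, hL⟩ := h
  refine ⟨(L : ℝ) + 1, fun t ↦ ?_⟩
  have h1 := sleKappaFourRaw_mono hy hyx hωG (show t ≤ ((⌈(t : ℝ)⌉₊ : ℕ) : ℝ≥0) from by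
    rw [← NNReal.coe_le_coe]; push_cast; exact Nat.le_ceil _)
  exact h1.trans (hL _).le

end Stopped

/-! ### Lemma 7.2 at `κ = 4` -/

section Main

/-- **Rohde–Schramm's Lemma 7.2 at `κ = 4`, positive points**: if SLE₄ is generated by a curve,
then for every `x > 0`, almost surely `x ∉ cl γ[0, ∞)`. With `y = x/2`: a.s. `T_y = ∞` and
`sup_t ∫₀ᵗ q < ∞` (`ae_exists_forall_sleKappaFourRaw_le`), and
`Q(t) = log |gₜ'(x)| - log(gₜ(x) - gₜ(y)) = -log(x - y) + ∫₀ᵗ q` (`log_norm_deriv_map_ofReal`,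
`log_gap_eq`), so the deterministic Koebe step applies.
[cite: RohdeSchramm2005, Lemma 7.2] -/
theorem ae_ofReal_notMem_closure_range_sleTrace_four_of_pos (h0 : HasSLETrace 4) {x : ℝ} (hx : 0 < x) :
    ∀ᵐ ω ∂preWienerMeasure, (x : ℂ) ∉ closure (range (sleTrace 4 ω)) := by
  have hy : 0 < x / 2 := by positivity
  have hyx : x / 2 < x := by linarith
  filter_upwards [ae_isGeneratedByCurve_sleTrace h0, ae_exists_forall_sleKappaFourRaw_le hy hyx,
    ae_sle_swallowingTime_eq_top_of_le_four (κ := 4) (by norm_num) le_rfl hy] with ω hγ hL hT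
  obtain ⟨L, hL⟩ := hL
  have hW : Continuous (sleDriving 4 ω) := continuous_sleDriving 4 ω
  have hyW : sleDriving 4 ω 0 < x / 2 := by rw [sleDriving_zero]; exact hy
  refine hγ.ofReal_notMem_closure_range_of_gap_bound hW hyW hyx hT (L := -Real.log (x - x / 2) + L)
    fun t ↦ ?_
  have hTy : (t : WithTop ℝ≥0) < swallowingTime (sleDriving 4 ω) (x / 2 : ℝ) := by
    rw [hT]; exact WithTop.coe_lt_top t
  have hTall : ∀ s : ℝ≥0, (s : WithTop ℝ≥0) < swallowingTime (sleDriving 4 ω) (x / 2 : ℝ) := fun s ↦ by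
    rw [hT]; exact WithTop.coe_lt_top s
  have hTxall : ∀ s : ℝ≥0, (s : WithTop ℝ≥0) < swallowingTime (sleDriving 4 ω) x := fun s ↦
    lt_of_lt_of_le (hTall s) (swallowingTime_mono_right hW hyW hyx.le)
  -- the flows are the frozen flows
  have hXeq : ∀ s : ℝ≥0, realFlow (sleDriving 4 ω) x s = sleRealFlowStop 4 x s ω := fun s ↦ by
    rw [sleRealFlowStop_apply, realFlowStop_of_lt (hTxall s)]
  have hYeq : ∀ s : ℝ≥0, realFlow (sleDriving 4 ω) (x / 2) s = sleRealFlowStop 4 (x / 2) s ω := fun s ↦ by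
    rw [sleRealFlowStop_apply, realFlowStop_of_lt (hTall s)]
  have hgapeq : (map (sleDriving 4 ω) t x).re - (map (sleDriving 4 ω) t (x / 2 : ℝ)).re =
      sleRealFlowStop 4 x t ω - sleRealFlowStop 4 (x / 2) t ω := by
    rw [← hXeq, ← hYeq, realFlow_apply, realFlow_apply]
    push_cast
    ring
  have hlogder := log_norm_deriv_map_ofReal hW (hyW.trans hyx) (hTxall t)
  have hgap := log_gap_eq hy hyx hTy
  -- integrability of the two rates on `[0, t]`
  have hpos : ∀ s : ℝ≥0, 0 < sleRealFlowStop 4 (x / 2) s ω ∧ sleRealFlowStop 4 (x / 2) s ω < sleRealFlowStop 4 x s ω :=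
    fun s ↦ by
      have h := sleRealFlowStop_sameSide_facts (κ := 4) hy hyx (hTall s)
      exact ⟨h.1, h.2.1⟩
  have hXc := (continuous_sleRealFlowStop (κ := 4) hx.ne' ω).comp continuous_real_toNNReal
  have hYc := (continuous_sleRealFlowStop (κ := 4) hy.ne' ω).comp continuous_real_toNNReal
  have hI1 : IntervalIntegrable (fun s : ℝ ↦
      2 / (sleRealFlowStop 4 x s.toNNReal ω * sleRealFlowStop 4 (x / 2) s.toNNReal ω)) volume 0 t :=
    (continuous_const.div (hXc.mul hYc) fun s ↦ mul_ne_zero ((hpos _).1.trans (hpos _).2).ne'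
      (hpos _).1.ne').intervalIntegrable _ _
  have hI2 : IntervalIntegrable (fun s : ℝ ↦ 2 / sleRealFlowStop 4 x s.toNNReal ω ^ 2) volume 0 t :=
    (continuous_const.div (hXc.pow 2) fun s ↦ (pow_pos ((hpos _).1.trans (hpos _).2) 2).ne').intervalIntegrable _ _
  have hraw : sleKappaFourRaw x (x / 2) t ω =
      (∫ s in (0 : ℝ)..t, 2 / (sleRealFlowStop 4 x s.toNNReal ω * sleRealFlowStop 4 (x / 2) s.toNNReal ω)) -
        ∫ s in (0 : ℝ)..t, 2 / sleRealFlowStop 4 x s.toNNReal ω ^ 2 := by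
    rw [← intervalIntegral.integral_sub hI1 hI2]
    rfl
  have hder' : Real.log ‖deriv (map (sleDriving 4 ω) t) x‖ =
      -∫ s in (0 : ℝ)..t, 2 / sleRealFlowStop 4 x s.toNNReal ω ^ 2 := by
    rw [hlogder, ← intervalIntegral.integral_neg]
    refine intervalIntegral.integral_congr fun s _ ↦ ?_
    simp only [hXeq]
    ring
  rw [hgapeq, hder', hgap]
  have := hL t
  rw [hraw] at this
  linarith

/-- The path-space event "**the point `c` is not in the closure of the range**", in measurable
form (tested at rational times). [folklore] -/
def ptAvoidSet (c : ℂ) : Set (ℝ≥0 → ℂ) :=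
  ⋃ k : ℕ, ⋂ q : ℚ, {p | 1 / ((k : ℝ) + 1) ≤ dist (p (q : ℝ).toNNReal) c}

/-- `ptAvoidSet c` is measurable. [folklore] -/
theorem measurableSet_ptAvoidSet (c : ℂ) : MeasurableSet (ptAvoidSet c) := by
  refine MeasurableSet.iUnion fun k ↦ MeasurableSet.iInter fun q ↦ ?_
  exact measurableSet_le measurable_const ((measurable_pi_apply _).dist measurable_const)

/-- For a **continuous** path `p`, `p ∈ ptAvoidSet c` iff `c ∉ cl (range p)`. [folklore] -/
theorem mem_ptAvoidSet_iff {p : ℝ≥0 → ℂ} (hp : Continuous p) (c : ℂ) :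
    p ∈ ptAvoidSet c ↔ c ∉ closure (range p) := by
  simp only [ptAvoidSet, mem_iUnion, mem_iInter, mem_setOf_eq]
  constructor
  · rintro ⟨k, hk⟩ hcl
    have hkpos : (0 : ℝ) < 1 / ((k : ℝ) + 1) := by positivity
    have hall : ∀ t : ℝ≥0, 1 / ((k : ℝ) + 1) ≤ dist (p t) c := by
      intro t
      by_contra hlt
      rw [not_le] at hlt
      have ho : IsOpen {u : ℝ≥0 | dist (p u) c < 1 / ((k : ℝ) + 1)} :=
        isOpen_lt (hp.dist continuous_const) continuous_const
      obtain ⟨δ, hδ, hball⟩ := Metric.isOpen_iff.1 ho t hlt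
      obtain ⟨q, htq, hqt⟩ := exists_rat_btwn (show (t : ℝ) < t + δ by linarith)
      have hq0 : (0 : ℝ) ≤ q := t.2.trans htq.le
      have hmem : (q : ℝ).toNNReal ∈ {u : ℝ≥0 | dist (p u) c < 1 / ((k : ℝ) + 1)} := by
        refine hball ?_
        rw [Metric.mem_ball, NNReal.dist_eq, Real.coe_toNNReal _ hq0, abs_sub_lt_iff]
        constructor <;> linarith
      exact absurd (hk q) (not_le.2 hmem)
    obtain ⟨_, ⟨t, rfl⟩, hdist⟩ := Metric.mem_closure_iff.1 hcl _ hkpos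
    rw [dist_comm] at hdist
    linarith [hall t]
  · intro h
    rw [Metric.mem_closure_iff] at h
    push Not at h
    obtain ⟨ε, hε, hfar⟩ := h
    obtain ⟨k, hk⟩ := exists_nat_one_div_lt hε
    refine ⟨k, fun q ↦ ?_⟩
    have := hfar (p ((q : ℝ).toNNReal)) ⟨_, rfl⟩
    rw [dist_comm] at this
    linarith

/-- **Rohde–Schramm's Lemma 7.2 at `κ = 4`, negative points, by reflection**: the reflected trace
`-γ̄` has the law of `γ` (`identDistrib_sleTrace_negConj`), and `x ∈ cl γ[0,∞)` iff
`-x ∈ cl (-γ̄)[0,∞)`. [cite: RohdeSchramm2005, Lemma 7.2] -/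
theorem ae_ofReal_notMem_closure_range_sleTrace_four_of_neg (h0 : HasSLETrace 4) {x : ℝ} (hx : x < 0) :
    ∀ᵐ ω ∂preWienerMeasure, (x : ℂ) ∉ closure (range (sleTrace 4 ω)) := by
  have hlaw := identDistrib_sleTrace_negConj h0
  have hpos := ae_ofReal_notMem_closure_range_sleTrace_four_of_pos h0 (neg_pos.2 hx)
  -- a.s. the trace avoids `-x`, i.e. lies in `ptAvoidSet (-x)`
  have h1 : ∀ᵐ ω ∂preWienerMeasure, sleTrace 4 ω ∈ ptAvoidSet ((-x : ℝ) : ℂ) := by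
    filter_upwards [h0, hpos] with ω hω h
    exact (mem_ptAvoidSet_iff (isGeneratedByCurve_trace hω).continuous _).2 h
  have h2 : preWienerMeasure ((fun ω t ↦ -(starRingEnd ℂ) (sleTrace 4 ω t)) ⁻¹' (ptAvoidSet ((-x : ℝ) : ℂ))ᶜ) = 0 := by
    rw [← hlaw.measure_mem_eq (measurableSet_ptAvoidSet _).compl]
    refine measure_eq_zero_iff_ae_notMem.2 ?_
    filter_upwards [h1] with ω hω
    simpa using hω
  have h3 : ∀ᵐ ω ∂preWienerMeasure, (fun t ↦ -(starRingEnd ℂ) (sleTrace 4 ω t)) ∈ ptAvoidSet ((-x : ℝ) : ℂ) := by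
    filter_upwards [measure_eq_zero_iff_ae_notMem.1 h2] with ω hω
    simpa only [mem_preimage, mem_compl_iff, not_not] using hω
  filter_upwards [h0, h3] with ω hω hav hxcl
  have hc : Continuous (sleTrace 4 ω) := (isGeneratedByCurve_trace hω).continuous
  have hφ : Continuous fun z : ℂ ↦ -(starRingEnd ℂ) z := Complex.continuous_conj.neg
  have hav' := (mem_ptAvoidSet_iff (hφ.comp hc) _).1 hav
  apply hav'
  have hsub := image_closure_subset_closure_image hφ (s := range (sleTrace 4 ω))
  have hmem : (fun z : ℂ ↦ -(starRingEnd ℂ) z) (x : ℂ) ∈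
      closure ((fun z : ℂ ↦ -(starRingEnd ℂ) z) '' range (sleTrace 4 ω)) :=
    hsub (mem_image_of_mem _ hxcl)
  rw [← range_comp] at hmem
  have hx' : (fun z : ℂ ↦ -(starRingEnd ℂ) z) (x : ℂ) = ((-x : ℝ) : ℂ) := by simp
  rw [hx'] at hmem
  exact hmem

/-- **Rohde–Schramm (2005), Lemma 7.2 at `κ = 4`**: if SLE₄ is generated by a curve
(`HasSLETrace 4`; Thm. 5.1), then for every real `x ≠ 0`, almost surely `x ∉ cl γ[0, ∞)`.
[cite: RohdeSchramm2005, Lemma 7.2] -/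
theorem ae_ofReal_notMem_closure_range_sleTrace_four (h0 : HasSLETrace 4) {x : ℝ} (hx : x ≠ 0) :
    ∀ᵐ ω ∂preWienerMeasure, (x : ℂ) ∉ closure (range (sleTrace 4 ω)) := by
  rcases lt_or_gt_of_ne hx with h | h
  · exact ae_ofReal_notMem_closure_range_sleTrace_four_of_neg h0 h
  · exact ae_ofReal_notMem_closure_range_sleTrace_four_of_pos h0 h

end Main

end Literature.Probability.RandomPlanarGeometry
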